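import Mathlib
import HarnessLib
import Summits.MatrixMultiplication.MatrixMultiplication.Theses.AutomaticSTPPDesigns
import Summits.MatrixMultiplication.MatrixMultiplication.Theses.GroupTheoreticSTPP
import Summits.MatrixMultiplication.MatrixMultiplication.Theorems.AutomaticSTPPDesignsAutomaticPackingThesisSplit
import Summits.MatrixMultiplication.MatrixMultiplication.Theorems.AutomaticSTPPDesignsAutomaticPackingThesisCruxGivesCThesis
import Literature.Barriers.MatrixMultiplication.TricoloredSumFreeBarrier
import Literature.Combinatorics.Additive.TricoloredSumFreeBound
import Literature.Computability.AlgebraicComplexity.GroupTheoreticMatMulThmBProofs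

/-!
# Line `cyclic-universality` — crux `AutomaticPackingThesis` (stmt-MatrixMultiplication-7356)

Crux-strategist redirect r1. THE LEVER: the BCCGNSU slice-rank saving is exponential in the
p-RANK `r` of the host (`e^{-δ r}`, uniformly in the exponents of the cyclic factors), and the
mixed-radix transfer to a cyclic group loses exactly `3^r`; Hölder between the exponents `2/3` and
`τ'` trades the one against the other (Pratt 2024, proof of Thm. 4.4, run over ALL finite abelian
groups and concluding STPP-in-cyclic at every exponent instead of `Val(ℤ_n) ≥ n^{1+c}`). Hence

  `CThesis (X_C, stmt-0593) → AutomaticPackingThesis`   (the converse is the tree theorem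
  `cThesis_of_automaticPackingThesis`), i.e. the crux is EQUIVALENT to route C's abelian thesis:
  cyclic groups — indeed 2-automatic cyclic towers — are universal hosts for abelian STPP packings.

The assembly `AutomaticPackingThesis_of_subs : RankPackingLaw → InvariantFactorForm → X_C → crux`
is PROVED and landed (p165957, `Theorems/AutomaticSTPPDesignsAutomaticPackingThesisSplit.lean`).
This skeleton cuts the two PROVABLE pieces into worker-sized stubs (1–4) and carries X_C as the
residual stub 5 (= item stmt-MatrixMultiplication-0593 verbatim; NOT a target for this line's
provers — it is route `GroupTheoreticSTPP`'s target; once stubs 1–4 land, the final-cycle lead files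
`route edit --split AutomaticPackingThesis --into RankPackingLaw InvariantFactorForm
AbelianPackingThesis --glue-by …AutomaticPackingThesis_of_subs`, children.json in the strategist's
folder / line card).

Stubs:
1. `stub_mixedSliceRankBound` — BCCGNSU Thm. 4.14 in MIXED-exponent form: tricolored sum-free sets
   in `H ≃ (Π_{l∈κ} ℤ/p^{k_l}) × G` (`k_l ≥ 1`) have size `≤ 3|H|e^{-δ|κ|}` (weighted low-weight
   count; generalises `hasSliceRankLE_piZMod` + `card_lowWeight_mul_pow_le` + `card_le_of_addEquiv_J`).
2. `stub_rankClassPowers` — the rank class is closed under `H ↦ (Fin N' → (Fin N → H)³)`: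
   a reindexing `AddEquiv` with index `Fin N' × (Fin N ⊕ Fin N ⊕ Fin N) × Fin r`.
3. `stub_engine` — BCCGNSU §3.2 ENGINE with an abstract ceiling `Y`: if tricolored sum-free sets in
   all `(Fin N' → (Fin N → H)³)` have size `≤ 3 (Y^{3N})^{N'}` then every STPP family in `H` has
   `Σ xᵢ^{2/3} ≤ Y` (the tree proof of `AddSimultaneousTPP.exists_sum_rpow_le`, verbatim with `Y`
   for `|H|^{1-δ}`: Thm. 3.3, Lemma 3.4, Lemma 3.5, `le_of_pow_le_poly_mul_pow`).
4. `stub_invariantFactorForm` — structure theorem, invariant-factor form with the p-part split off.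
5. `stub_abelianPackingThesis` — X_C (residual; = `CThesis`, stmt-0593).
Compositions (real proofs): `rankPackingLaw_of_stubs : 1 → 2 → 3 → RankPackingLaw`,
`AutomaticPackingThesis_of : 1 → 2 → 3 → 4 → 5 → AutomaticPackingThesis`.
-/

-- single-conjunct summit: the mandated namespace repeats `MatrixMultiplication`.
set_option linter.dupNamespace false

noncomputable section

namespace Summit.MatrixMultiplication.MatrixMultiplication.Cruxes.AutomaticPackingThesis.CyclicUniversality

open Finset Literature.Combinatorics.Additive Literature.Computability.AlgebraicComplexity
open Literature.Barriers.MatrixMultiplication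
open Summit.MatrixMultiplication.MatrixMultiplication.Theses.AutomaticSTPPDesigns
open Summit.MatrixMultiplication.MatrixMultiplication.Theses.GroupTheoreticSTPP (CThesis)
open Summit.MatrixMultiplication.MatrixMultiplication.Theorems.AutomaticPackingThesis

/-- Stub 1 (BCCGNSU 2017 Thm. 4.14, MIXED-exponent form; size L): for a prime `p`, a finite index
type `κ`, exponents `k_l ≥ 1` and ANY finite abelian `G`, every tricolored sum-free set in
`H ≃ (Π_{l∈κ} ℤ/p^{k_l}) × G` has size `≤ 3|H|e^{-δ|κ|}`, `δ = bccgnsuDelta = log((2/3)2^{2/3})`.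
Proof route: the slice decomposition of `hasSliceRankLE_piZMod` coordinate by coordinate
(`shiftedIndicator_eq_sum (k l)` in coordinate `l`), classes by the WEIGHTED degree
`Σ_l λ_l a_l ≤ Σ_l λ_l (q_l - 1)/3` (`λ_l = -log x_l`, `x_l` a near-minimiser of
`f_{q_l}(x) = (Σ_{b<q_l} x^b) x^{-(q_l-1)/3}`), Chernoff count `#LowWeight_λ ≤ Π_l f_{q_l}(x_l)`,
`inf f_q = q J(q) ≤ q e^{-δ}` (`bccgnsuJ_le_exp_neg_delta`), and `HasSliceRankLE.mul_tensor` for `G`.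
[cite: BlasiakChurchCohnGrochowNaslundSawinUmans2017, Thm. 4.14] -/
theorem stub_mixedSliceRankBound (p : ℕ) (hp : p.Prime) (κ : Type) [Fintype κ] (k : κ → ℕ)
    (hk : ∀ l, 1 ≤ k l) (G : Type) [AddCommGroup G] [Fintype G] (H : Type) [AddCommGroup H]
    [Fintype H] (e : H ≃+ (((l : κ) → ZMod (p ^ k l)) × G)) (ι : Type) [Fintype ι]
    (s t u : ι → H) (h : IsTricoloredSumFree s t u) :
    (Fintype.card ι : ℝ) ≤ 3 * Fintype.card H * Real.exp (-(bccgnsuDelta * Fintype.card κ)) := by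
  sorry

/-- Stub 2 (the rank class is closed under the power construction of BCCGNSU §3.2; size M): a
reindexing additive equivalence
`(Fin N' → (Fin N → H)³) ≃ (Π_{(m, c, j)} ℤ/p^{k_j}) × (Fin N' → (Fin N → G)³)` along
`H ≃ (Π_j ℤ/p^{k_j}) × G`, index `Fin N' × (Fin N ⊕ Fin N ⊕ Fin N) × Fin r`. [folklore] -/
theorem stub_rankClassPowers (p r : ℕ) (k : Fin r → ℕ) (G : Type) [AddCommGroup G] (H : Type)
    [AddCommGroup H] (e : H ≃+ (((j : Fin r) → ZMod (p ^ k j)) × G)) (N N' : ℕ) :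
    Nonempty ((Fin N' → (Fin N → H) × (Fin N → H) × (Fin N → H)) ≃+
      ((((l : Fin N' × (Fin N ⊕ Fin N ⊕ Fin N) × Fin r) → ZMod (p ^ k l.2.2))) ×
        (Fin N' → (Fin N → G) × (Fin N → G) × (Fin N → G)))) := by
  sorry

/-- Stub 3 (BCCGNSU 2017 §3.2 ENGINE with an abstract ceiling; size L): if for every `N ≥ 1` and
`N'` the tricolored sum-free sets in `(Fin N' → (Fin N → H)³)` have size `≤ 3 (Y^{3N})^{N'}`, then
every STPP family in `H` has `Σᵢ (|Aᵢ||Bᵢ||Cᵢ|)^{2/3} ≤ Y`. The tree proof of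
`AddSimultaneousTPP.exists_sum_rpow_le` verbatim with `Y` in place of `|H|^{1-δ}`
(`card_fiber_pow_three_mul_sq_le`, `exists_isBorderTricoloredSumFree`,
`exists_isTricoloredSumFree_pi`, `le_of_pow_le_poly_mul_pow`).
[cite: BlasiakChurchCohnGrochowNaslundSawinUmans2017, Lemma 3.5 and §3.2] -/
theorem stub_engine (H : Type) [AddCommGroup H] [Fintype H] [DecidableEq H] (Y : ℝ) (hY : 0 < Y)
    (hTSF : ∀ N : ℕ, 1 ≤ N → ∀ (N' : ℕ) (ι' : Type) [Fintype ι']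
      (s t u : ι' → (Fin N' → (Fin N → H) × (Fin N → H) × (Fin N → H))),
      IsTricoloredSumFree s t u → (Fintype.card ι' : ℝ) ≤ 3 * (Y ^ (3 * N)) ^ N')
    (ι₀ : Type) [Fintype ι₀] [DecidableEq ι₀] (A B C : ι₀ → Finset H)
    (hS : AddSimultaneousTPP A B C) :
    ∑ i, (((A i).card * (B i).card * (C i).card : ℕ) : ℝ) ^ ((2 : ℝ) / 3) ≤ Y := by
  sorry

/-- Stub 4 (structure theorem of finite abelian groups, invariant-factor form with the `p`-part
split off; size M): `H ≃ Π_{j<r} ℤ/d_j` and `H ≃ (Π_{j<r} ℤ/p^{k_j}) × G` with the SAME `r`, all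
`k_j ≥ 1`. Route: `AddCommGroup.equiv_directSum_zmod_of_finite`, regroup the primary factors of the
other primes into the `r = max_p rank_p` slots of a prime `p` of maximal rank (`ZMod` CRT), split
each `ℤ/d_j ≃ ℤ/p^{v_p(d_j)} × ℤ/(d_j/p^{v_p(d_j)})`. [folklore] -/
theorem stub_invariantFactorForm (H : Type) [AddCommGroup H] [Fintype H]
    (hH : 1 < Fintype.card H) :
    ∃ (p r : ℕ) (k d : Fin r → ℕ) (G : Type) (_ : AddCommGroup G) (_ : Fintype G),
      p.Prime ∧ (∀ j, 1 ≤ k j) ∧ (∀ j, 1 ≤ d j) ∧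
      Nonempty (H ≃+ ((j : Fin r) → ZMod (d j))) ∧
      Nonempty (H ≃+ (((j : Fin r) → ZMod (p ^ k j)) × G)) := by
  sorry

/-- Stub 5 — THE RESIDUAL, NOT FOR THIS LINE'S PROVERS: X_C, the target `CThesis` of route
`GroupTheoreticSTPP` (item stmt-MatrixMultiplication-0593), verbatim. With stubs 1–4 it is
EQUIVALENT to the crux (`automaticPackingThesis_iff_cThesis`, below); its attack is route C's
(cruxes `CPackingConstruction` = CKSU Conj. 4.7, `CAbelianObstructionNeg`). Conjecture-grade.
[cite: CohnKleinbergSzegedyUmans2005, Def. 5.1 and Thm. 5.5] -/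
theorem stub_abelianPackingThesis : ∀ ε : ℝ, 0 < ε → ∃ (H : Type) (_ : AddCommGroup H)
    (_ : Fintype H) (N : ℕ) (A B C : Fin N → Finset H), (∀ i j k : Fin N, ∀ s ∈ A k, ∀ s' ∈ A i,
      ∀ t ∈ B i, ∀ t' ∈ B j, ∀ u ∈ C j, ∀ u' ∈ C k, (s' - s) + (t' - t) + (u' - u) = 0 →
        i = j ∧ j = k ∧ s = s' ∧ t = t' ∧ u = u') ∧
      (Fintype.card H : ℝ) < ∑ i, (((A i).card * (B i).card * (C i).card : ℕ) : ℝ) ^ ((2 + ε) / 3) := by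
  sorry

/-! ### Compositions (real proofs) -/

/-- **Stubs 1–3 give the RANK PACKING LAW** (split child `RankPackingLaw`, verbatim): with
`δ = bccgnsuDelta`, every STPP family in `H ≃ (Π_{j<r} ℤ/p^{k_j}) × G` has
`Σᵢ (|Aᵢ||Bᵢ||Cᵢ|)^{2/3} ≤ e^{-δ r}|H|` — the engine (stub 3) at `Y = e^{-δ r}|H|`, fed by the
mixed slice-rank bound (stub 1) in the powers `(Fin N' → (Fin N → H)³) ≃ (Π ℤ/p^{k}) × G'`
(stub 2), whose p-rank is `3NN'r`. [cite: BlasiakChurchCohnGrochowNaslundSawinUmans2017, §3.2]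
[cite: Pratt2024, Thm. 4.4 (proof)] -/
theorem rankPackingLaw_of_stubs
    (h1 : ∀ (p : ℕ), p.Prime → ∀ (κ : Type) [Fintype κ] (k : κ → ℕ), (∀ l, 1 ≤ k l) →
      ∀ (G : Type) [AddCommGroup G] [Fintype G] (H : Type) [AddCommGroup H] [Fintype H],
        (H ≃+ (((l : κ) → ZMod (p ^ k l)) × G)) → ∀ (ι : Type) [Fintype ι] (s t u : ι → H),
          IsTricoloredSumFree s t u →
            (Fintype.card ι : ℝ) ≤ 3 * Fintype.card H * Real.exp (-(bccgnsuDelta * Fintype.card κ)))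
    (h2 : ∀ (p r : ℕ) (k : Fin r → ℕ) (G : Type) [AddCommGroup G] (H : Type) [AddCommGroup H],
      (H ≃+ (((j : Fin r) → ZMod (p ^ k j)) × G)) → ∀ (N N' : ℕ),
        Nonempty ((Fin N' → (Fin N → H) × (Fin N → H) × (Fin N → H)) ≃+
          ((((l : Fin N' × (Fin N ⊕ Fin N ⊕ Fin N) × Fin r) → ZMod (p ^ k l.2.2))) ×
            (Fin N' → (Fin N → G) × (Fin N → G) × (Fin N → G)))))
    (h3 : ∀ (H : Type) [AddCommGroup H] [Fintype H] [DecidableEq H] (Y : ℝ), 0 < Y →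
      (∀ N : ℕ, 1 ≤ N → ∀ (N' : ℕ) (ι' : Type) [Fintype ι']
        (s t u : ι' → (Fin N' → (Fin N → H) × (Fin N → H) × (Fin N → H))),
        IsTricoloredSumFree s t u → (Fintype.card ι' : ℝ) ≤ 3 * (Y ^ (3 * N)) ^ N') →
      ∀ (ι₀ : Type) [Fintype ι₀] [DecidableEq ι₀] (A B C : ι₀ → Finset H),
        AddSimultaneousTPP A B C →
          ∑ i, (((A i).card * (B i).card * (C i).card : ℕ) : ℝ) ^ ((2 : ℝ) / 3) ≤ Y) :
    ∃ δ : ℝ, 0 < δ ∧ ∀ (p r : ℕ) (k : Fin r → ℕ), p.Prime → (∀ j, 1 ≤ k j) →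
      ∀ (G : Type) [AddCommGroup G] [Fintype G] (H : Type) [AddCommGroup H] [Fintype H],
        Nonempty (H ≃+ (((j : Fin r) → ZMod (p ^ k j)) × G)) →
        ∀ (N : ℕ) (A B C : Fin N → Finset H), Literature.Computability.AlgebraicComplexity.IsSTPP A B C →
          ∑ i, (((A i).card * (B i).card * (C i).card : ℕ) : ℝ) ^ ((2 : ℝ) / 3) ≤
            Real.exp (-(δ * r)) * (Fintype.card H : ℝ) := by
  classical
  refine ⟨bccgnsuDelta, bccgnsuDelta_pos, ?_⟩
  intro p r k hp hk G _ _ H _ _ hH N A B C hS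
  obtain ⟨e⟩ := hH
  have hHpos : (0 : ℝ) < Fintype.card H := by exact_mod_cast Fintype.card_pos
  set Y : ℝ := Real.exp (-(bccgnsuDelta * r)) * Fintype.card H with hYdef
  have hY : 0 < Y := mul_pos (Real.exp_pos _) hHpos
  -- the tricolored sum-free ceiling in the powers, from stubs 1 and 2
  have hTSF : ∀ N₁ : ℕ, 1 ≤ N₁ → ∀ (N' : ℕ) (ι' : Type) [Fintype ι']
      (s t u : ι' → (Fin N' → (Fin N₁ → H) × (Fin N₁ → H) × (Fin N₁ → H))),
      IsTricoloredSumFree s t u → (Fintype.card ι' : ℝ) ≤ 3 * (Y ^ (3 * N₁)) ^ N' := by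
    intro N₁ _ N' ι' _ s t u hT
    obtain ⟨e'⟩ := h2 p r k G H e N₁ N'
    have hb := h1 p hp (Fin N' × (Fin N₁ ⊕ Fin N₁ ⊕ Fin N₁) × Fin r) (fun l => k l.2.2)
      (fun l => hk l.2.2) (Fin N' → (Fin N₁ → G) × (Fin N₁ → G) × (Fin N₁ → G))
      (Fin N' → (Fin N₁ → H) × (Fin N₁ → H) × (Fin N₁ → H)) e' ι' s t u hT
    have hκ : Fintype.card (Fin N' × (Fin N₁ ⊕ Fin N₁ ⊕ Fin N₁) × Fin r) = N' * (3 * N₁) * r := by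
      simp only [Fintype.card_prod, Fintype.card_sum, Fintype.card_fin]; ring
    have hbig : (Fintype.card (Fin N' → (Fin N₁ → H) × (Fin N₁ → H) × (Fin N₁ → H)) : ℝ) =
        (Fintype.card H : ℝ) ^ (3 * N₁ * N') := by
      rw [Fintype.card_fun, Fintype.card_prod, Fintype.card_prod, Fintype.card_fun,
        Fintype.card_fin, Fintype.card_fin]
      push_cast
      ring
    rw [hκ, hbig] at hb
    refine hb.trans (le_of_eq ?_)
    have hexp : Real.exp (-(bccgnsuDelta * ((N' * (3 * N₁) * r : ℕ) : ℝ))) =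
        Real.exp (-(bccgnsuDelta * (r : ℝ))) ^ (3 * N₁ * N') := by
      rw [← Real.exp_nat_mul]
      congr 1
      push_cast
      ring
    rw [hexp]
    ring
  exact h3 H Y hY hTSF (Fin N) A B C ((isSTPP_iff_addSimultaneousTPP A B C).1 hS)

/-- **Composition.** Stubs 1–5 imply the crux `AutomaticPackingThesis` BY NAME: stubs 1–3 give
`RankPackingLaw` (`rankPackingLaw_of_stubs`), stub 4 is `InvariantFactorForm`, stub 5 is X_C, and the
landed assembly `AutomaticPackingThesis_of_subs` (p165957) concludes.
[cite: Pratt2024, Thm. 4.4 (proof) and Remark 4.6] -/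
theorem AutomaticPackingThesis_of
    (h1 : ∀ (p : ℕ), p.Prime → ∀ (κ : Type) [Fintype κ] (k : κ → ℕ), (∀ l, 1 ≤ k l) →
      ∀ (G : Type) [AddCommGroup G] [Fintype G] (H : Type) [AddCommGroup H] [Fintype H],
        (H ≃+ (((l : κ) → ZMod (p ^ k l)) × G)) → ∀ (ι : Type) [Fintype ι] (s t u : ι → H),
          IsTricoloredSumFree s t u →
            (Fintype.card ι : ℝ) ≤ 3 * Fintype.card H * Real.exp (-(bccgnsuDelta * Fintype.card κ)))
    (h2 : ∀ (p r : ℕ) (k : Fin r → ℕ) (G : Type) [AddCommGroup G] (H : Type) [AddCommGroup H],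
      (H ≃+ (((j : Fin r) → ZMod (p ^ k j)) × G)) → ∀ (N N' : ℕ),
        Nonempty ((Fin N' → (Fin N → H) × (Fin N → H) × (Fin N → H)) ≃+
          ((((l : Fin N' × (Fin N ⊕ Fin N ⊕ Fin N) × Fin r) → ZMod (p ^ k l.2.2))) ×
            (Fin N' → (Fin N → G) × (Fin N → G) × (Fin N → G)))))
    (h3 : ∀ (H : Type) [AddCommGroup H] [Fintype H] [DecidableEq H] (Y : ℝ), 0 < Y →
      (∀ N : ℕ, 1 ≤ N → ∀ (N' : ℕ) (ι' : Type) [Fintype ι']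
        (s t u : ι' → (Fin N' → (Fin N → H) × (Fin N → H) × (Fin N → H))),
        IsTricoloredSumFree s t u → (Fintype.card ι' : ℝ) ≤ 3 * (Y ^ (3 * N)) ^ N') →
      ∀ (ι₀ : Type) [Fintype ι₀] [DecidableEq ι₀] (A B C : ι₀ → Finset H),
        AddSimultaneousTPP A B C →
          ∑ i, (((A i).card * (B i).card * (C i).card : ℕ) : ℝ) ^ ((2 : ℝ) / 3) ≤ Y)
    (h4 : ∀ (H : Type) [AddCommGroup H] [Fintype H], 1 < Fintype.card H →
      ∃ (p r : ℕ) (k d : Fin r → ℕ) (G : Type) (_ : AddCommGroup G) (_ : Fintype G),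
        p.Prime ∧ (∀ j, 1 ≤ k j) ∧ (∀ j, 1 ≤ d j) ∧
        Nonempty (H ≃+ ((j : Fin r) → ZMod (d j))) ∧
        Nonempty (H ≃+ (((j : Fin r) → ZMod (p ^ k j)) × G)))
    (h5 : ∀ ε : ℝ, 0 < ε → ∃ (H : Type) (_ : AddCommGroup H) (_ : Fintype H) (N : ℕ)
      (A B C : Fin N → Finset H), (∀ i j k : Fin N, ∀ s ∈ A k, ∀ s' ∈ A i, ∀ t ∈ B i, ∀ t' ∈ B j,
        ∀ u ∈ C j, ∀ u' ∈ C k, (s' - s) + (t' - t) + (u' - u) = 0 →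
          i = j ∧ j = k ∧ s = s' ∧ t = t' ∧ u = u') ∧
      (Fintype.card H : ℝ) < ∑ i, (((A i).card * (B i).card * (C i).card : ℕ) : ℝ) ^ ((2 + ε) / 3)) :
    AutomaticPackingThesis :=
  AutomaticPackingThesis_of_subs (rankPackingLaw_of_stubs h1 h2 h3) h4 h5

/-- The line closes the crux modulo its stubs (kernel check of the composition's shape). -/
theorem AutomaticPackingThesis_line : AutomaticPackingThesis :=
  AutomaticPackingThesis_of stub_mixedSliceRankBound
    (fun p r k G _ H _ e N N' => stub_rankClassPowers p r k G H e N N') stub_engine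
    stub_invariantFactorForm stub_abelianPackingThesis

/-- **Cyclic universality modulo stubs 1–4** (no X_C assumed): `AutomaticPackingThesis ↔ CThesis`.
[cite: Pratt2024, Thm. 4.4 (proof) and Remark 4.6] -/
theorem automaticPackingThesis_iff_cThesis : AutomaticPackingThesis ↔ CThesis :=
  automaticPackingThesis_iff_cThesis_of_subs
    (rankPackingLaw_of_stubs stub_mixedSliceRankBound
      (fun p r k G _ H _ e N N' => stub_rankClassPowers p r k G H e N N') stub_engine)
    stub_invariantFactorForm

end Summit.MatrixMultiplication.MatrixMultiplication.Cruxes.AutomaticPackingThesis.CyclicUniversality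

end
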